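import Mathlib
import HarnessLib
import Summits.NavierStokesRegularity.NavierStokesRegularity.Theorems.PoloidalWindowDoorLrcModEntireCurvedSheetTransport

/-!
# Route `PoloidalWindowDoor`, item `LrcModEntire` (stmt-NavierStokesRegularity-20428), cell (Q4-curved) of the (TH) column —
# B-JETc LOCAL IN THE ARCLENGTH: `curved_sheet_jet` / `curved_sheet_cubic_law` on a product `S × I` of open sets

Cell ns-regularity-ideate, helper seat ns-k2-port-2 g9 under the LEAD of item 20428 (ns-poloidal-K2-p3 g17 / successor g18).  The assembly of TOWER-CLOSES §E consumes
ns-poloidal-K2-p2 g18's B-TWPc, which is LOCAL in the arclength `σ` (23:29:00Z design: for every `σ₀` an open box); `…CurvedSheetJet.curved_sheet_jet` (this seat, p749681) asks for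
web criticality for ALL `s : ℝ`.  This file is the same computation with `s` restricted to an open set `S` (the region `ℝ × I` replaced by `S ×ˢ I`); nothing else changes.
`--supports stmt-NavierStokesRegularity-20428 --as helper`.  CLASS-FREE.

* `fderiv_eq_zero_of_eqOn_prod` — a function vanishing on the open product has vanishing derivative there;
* `curved_sheet_jet_on`, ★ `curved_sheet_cubic_law_on`, `curved_sheet_cubic_law_on'` — items (i)–(vii) and the cubic law of `…CurvedSheetJet` on `S ×ˢ I`.

WHAT THIS IS NOT: not a claim about Navier–Stokes regularity and not a stub of the registry; class-free calculus for the residual research cells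
`stub_Q4curvedAperiodic` / `stub_Q4sonicLineNegIsolated` of `Cruxes/LrcModEntire/Lines/twist_split.lean` (v14; items 20428 / 19708 / 27893 OPEN).
-/

noncomputable section

set_option linter.dupNamespace false

namespace Summit.NavierStokesRegularity.NavierStokesRegularity.Theorems.PoloidalWindowDoorLrcModEntireCurvedSheetJetLocal

open Set Function Filter Topology
open scoped InnerProductSpace RealInnerProductSpace ContDiff
open Summit.NavierStokesRegularity.NavierStokesRegularity.Theorems.PoloidalWindowDoorLrcModEntireSheetFlattenTools
open Summit.NavierStokesRegularity.NavierStokesRegularity.Theorems.PoloidalWindowDoorLrcModEntireParallelWebsIdentity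
open Summit.NavierStokesRegularity.NavierStokesRegularity.Theorems.PoloidalWindowDoorLrcModEntireRidgeGlobalBranchODE
open Summit.NavierStokesRegularity.NavierStokesRegularity.Theorems.PoloidalWindowDoorLrcModEntireRidgeGlobalBranchFrame
open Summit.NavierStokesRegularity.NavierStokesRegularity.Theorems.PoloidalWindowDoorLrcModEntirePlanarCurveRigidity
open Summit.NavierStokesRegularity.NavierStokesRegularity.Theorems.PoloidalWindowDoorLrcModEntireCurvedWebHuygens
open Summit.NavierStokesRegularity.NavierStokesRegularity.Theorems.PoloidalWindowDoorLrcModEntireCurvedSheetTransport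

/-- A function vanishing on the open product `S × I` has vanishing derivative there. -/
theorem fderiv_eq_zero_of_eqOn_prod {S I : Set ℝ} (hS : IsOpen S) (hI : IsOpen I) {φ : ℝ × ℝ → ℝ} (hφ : ∀ p ∈ S ×ˢ I, φ p = 0)
    {p : ℝ × ℝ} (hp : p ∈ S ×ˢ I) (h : ℝ × ℝ) : fderiv ℝ φ p h = 0 := by
  have hev : φ =ᶠ[𝓝 p] fun _ => 0 :=
    Filter.eventuallyEq_of_mem ((hS.prod hI).mem_nhds hp) fun q hq => hφ q hq
  rw [hev.fderiv_eq]; simp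

/-- **THE JET OF `θ` AT A POINT OF A CURVED PARALLEL WEB SHEET.**  See the module docstring, items (i)–(vii). -/
theorem curved_sheet_jet_on {θ : EuclideanSpace ℝ (Fin 3) → ℝ} (hθ : ContDiff ℝ ∞ θ)
    {S I : Set ℝ} (hS : IsOpen S) (hI : IsOpen I) {μ d : ℝ → ℝ} (hμ : ∀ z ∈ I, DifferentiableAt ℝ μ z) (hd : ContDiffOn ℝ ∞ d I)
    {Γ : ℝ → EuclideanSpace ℝ (Fin 3)} (hΓ : ContDiff ℝ 2 Γ) (hpl : ∀ s, Γ s 2 = 0) (hun : ∀ s, ‖deriv Γ s‖ = 1)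
    {k : ℝ → ℝ} (hk : ∀ s, deriv (deriv Γ) s = k s • rotJ (deriv Γ s))
    (hJ : ∀ s ∈ S, ∀ z ∈ I, 1 - k s * d z ≠ 0)
    (hlaw : ∀ x : EuclideanSpace ℝ (Fin 3), x 2 ∈ I →
      fderiv ℝ (fun y => fderiv ℝ θ y (EuclideanSpace.single 2 (1 : ℝ))) x (EuclideanSpace.single 2 (1 : ℝ)) =
        -μ (x 2) * (fderiv ℝ (fun y => fderiv ℝ θ y (EuclideanSpace.single 0 (1 : ℝ))) x (EuclideanSpace.single 0 (1 : ℝ)) +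
          fderiv ℝ (fun y => fderiv ℝ θ y (EuclideanSpace.single 1 (1 : ℝ))) x (EuclideanSpace.single 1 (1 : ℝ))))
    (hν : ∀ s ∈ S, ∀ z ∈ I, fderiv ℝ θ (Γ s + d z • rotJ (deriv Γ s) + z • e2) (rotJ (deriv Γ s)) = 0)
    (hT : ∀ s ∈ S, ∀ z ∈ I, fderiv ℝ θ (Γ s + d z • rotJ (deriv Γ s) + z • e2) (deriv Γ s) = 0)
    {s z : ℝ} (hs : s ∈ S) (hz : z ∈ I) :
    fderiv ℝ (fderiv ℝ θ) (Γ s + d z • rotJ (deriv Γ s) + z • e2) (deriv Γ s) (rotJ (deriv Γ s)) = 0 ∧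
    fderiv ℝ (fderiv ℝ θ) (Γ s + d z • rotJ (deriv Γ s) + z • e2) (deriv Γ s) (deriv Γ s) = 0 ∧
    (1 - k s * d z) * fderiv ℝ (fderiv ℝ (fderiv ℝ θ)) (Γ s + d z • rotJ (deriv Γ s) + z • e2) (rotJ (deriv Γ s)) (deriv Γ s) (deriv Γ s) +
        k s * fderiv ℝ (fderiv ℝ θ) (Γ s + d z • rotJ (deriv Γ s) + z • e2) (rotJ (deriv Γ s)) (rotJ (deriv Γ s)) = 0 ∧
    deriv d z * fderiv ℝ (fderiv ℝ θ) (Γ s + d z • rotJ (deriv Γ s) + z • e2) (rotJ (deriv Γ s)) (rotJ (deriv Γ s)) +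
        fderiv ℝ (fderiv ℝ θ) (Γ s + d z • rotJ (deriv Γ s) + z • e2) e2 (rotJ (deriv Γ s)) = 0 ∧
    deriv (deriv d) z * fderiv ℝ (fderiv ℝ θ) (Γ s + d z • rotJ (deriv Γ s) + z • e2) (rotJ (deriv Γ s)) (rotJ (deriv Γ s)) +
          deriv d z ^ 2 * fderiv ℝ (fderiv ℝ (fderiv ℝ θ)) (Γ s + d z • rotJ (deriv Γ s) + z • e2) (rotJ (deriv Γ s)) (rotJ (deriv Γ s)) (rotJ (deriv Γ s)) +
        2 * deriv d z * fderiv ℝ (fderiv ℝ (fderiv ℝ θ)) (Γ s + d z • rotJ (deriv Γ s) + z • e2) e2 (rotJ (deriv Γ s)) (rotJ (deriv Γ s)) +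
      fderiv ℝ (fderiv ℝ (fderiv ℝ θ)) (Γ s + d z • rotJ (deriv Γ s) + z • e2) (rotJ (deriv Γ s)) e2 e2 = 0 ∧
    fderiv ℝ (fderiv ℝ (fderiv ℝ θ)) (Γ s + d z • rotJ (deriv Γ s) + z • e2) (rotJ (deriv Γ s)) e2 e2 +
        μ z * (fderiv ℝ (fderiv ℝ (fderiv ℝ θ)) (Γ s + d z • rotJ (deriv Γ s) + z • e2) (rotJ (deriv Γ s)) (deriv Γ s) (deriv Γ s) +
          fderiv ℝ (fderiv ℝ (fderiv ℝ θ)) (Γ s + d z • rotJ (deriv Γ s) + z • e2) (rotJ (deriv Γ s)) (rotJ (deriv Γ s)) (rotJ (deriv Γ s))) = 0 ∧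
    HasDerivAt (fun z' : ℝ => fderiv ℝ (fderiv ℝ θ) (Γ s + d z' • rotJ (deriv Γ s) + z' • e2) (rotJ (deriv Γ s)) (rotJ (deriv Γ s)))
      (deriv d z * fderiv ℝ (fderiv ℝ (fderiv ℝ θ)) (Γ s + d z • rotJ (deriv Γ s) + z • e2) (rotJ (deriv Γ s)) (rotJ (deriv Γ s)) (rotJ (deriv Γ s)) +
        fderiv ℝ (fderiv ℝ (fderiv ℝ θ)) (Γ s + d z • rotJ (deriv Γ s) + z • e2) e2 (rotJ (deriv Γ s)) (rotJ (deriv Γ s))) z := by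
  -- smoothness
  have hθ3 : ContDiff ℝ 3 θ := hθ.of_le (by norm_cast)
  have hθ2 : ContDiff ℝ 2 θ := hθ.of_le (by norm_cast)
  have hD2c : ContDiff ℝ 1 (fderiv ℝ (fderiv ℝ θ)) := (hθ3.fderiv_right (m := 2) (by norm_cast)).fderiv_right (m := 1) (by norm_cast)
  have hD2 := hD2c.differentiable one_ne_zero
  -- derivatives of `d`
  have hdd : ∀ z ∈ I, DifferentiableAt ℝ d z := fun z hz => (hd.contDiffAt (hI.mem_nhds hz)).differentiableAt (by simp)
  have hd1 : ContDiffOn ℝ ∞ (deriv d) I := hd.deriv_of_isOpen hI (m := ∞) (by simp)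
  have hdd1 : ∀ z ∈ I, DifferentiableAt ℝ (deriv d) z := fun z hz => (hd1.contDiffAt (hI.mem_nhds hz)).differentiableAt (by simp)
  -- the web as a curved web map with `G q = d q.2`, on the product `S × I`
  set Gd : ℝ × ℝ → ℝ := fun q => d q.2 with hGd
  have hGdd : ∀ q ∈ (S ×ˢ I), DifferentiableAt ℝ Gd q := fun q hq => (hdd q.2 hq.2).comp q differentiableAt_snd
  have hGd_fd : ∀ q ∈ (S ×ˢ I), ∀ h : ℝ × ℝ, fderiv ℝ Gd q h = deriv d q.2 * h.2 := fun q hq h => by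
    rw [hGd, show (fun q : ℝ × ℝ => d q.2) = d ∘ Prod.snd from rfl, fderiv_comp q (hdd q.2 hq.2) differentiableAt_snd]
    simp [fderiv_snd, mul_comm]
  have hd'q : ∀ q ∈ (S ×ˢ I), HasFDerivAt (fun q : ℝ × ℝ => deriv d q.2)
      ((ContinuousLinearMap.smulRight (1 : ℝ →L[ℝ] ℝ) (deriv (deriv d) q.2)).comp (ContinuousLinearMap.snd ℝ ℝ ℝ)) q := fun q hq =>
    (hdd1 q.2 hq.2).hasDerivAt.hasFDerivAt.comp q hasFDerivAt_snd
  -- frame facts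
  have hT2s : ∀ s, deriv Γ s 2 = 0 := fun s => (deriv_horizontal hΓ hpl s).1
  have hν2s : ∀ s, rotJ (deriv Γ s) 2 = 0 := fun s => (rotJ_facts (hT2s s) (hun s)).1
  have hTd : ∀ s, HasDerivAt (deriv Γ) (k s • rotJ (deriv Γ s)) s := fun s => by
    have h := (hasDerivAt_of_contDiff_two hΓ s).2; rwa [hk s] at h
  have hNd : ∀ s, HasDerivAt (fun t => rotJ (deriv Γ t)) (-(k s) • deriv Γ s) s := hasDerivAt_normal hΓ hpl hk
  -- the web identities in the curved-web-map currency on the region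
  have hνW : ∀ q ∈ (S ×ˢ I), fderiv ℝ θ (Γ q.1 + Gd q • rotJ (deriv Γ q.1) + q.2 • e2) (rotJ (deriv Γ q.1)) = 0 :=
    fun q hq => hν q.1 hq.1 q.2 hq.2
  have hTW : ∀ q ∈ (S ×ˢ I), fderiv ℝ θ (Γ q.1 + Gd q • rotJ (deriv Γ q.1) + q.2 • e2) (deriv Γ q.1) = 0 :=
    fun q hq => hT q.1 hq.1 q.2 hq.2
  /- (i) `B[T,ν] = 0` and (ii) `B[T,T] = 0` on the region. -/
  have hBTν : ∀ q ∈ (S ×ˢ I), fderiv ℝ (fderiv ℝ θ) (Γ q.1 + Gd q • rotJ (deriv Γ q.1) + q.2 • e2) (deriv Γ q.1) (rotJ (deriv Γ q.1)) = 0 := by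
    intro q hq
    have h := fderiv_eq_zero_of_eqOn_prod hS hI hνW hq (1, 0)
    rw [fderiv_moving_deriv hΓ hpl hk (hGdd q hq) hθ2 (hNd q.1), hGd_fd q hq] at h
    have hT0q := hTW q hq
    simp only [map_smul, _root_.smul_apply, smul_eq_mul, mul_zero, zero_smul, add_zero, one_mul] at h
    have hkey : (1 - k q.1 * Gd q) * fderiv ℝ (fderiv ℝ θ) (Γ q.1 + Gd q • rotJ (deriv Γ q.1) + q.2 • e2) (deriv Γ q.1)
        (rotJ (deriv Γ q.1)) = 0 := by linear_combination h + k q.1 * hT0q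
    rcases mul_eq_zero.1 hkey with h1 | h1
    · exact absurd h1 (hJ q.1 hq.1 q.2 hq.2)
    · exact h1
  have hBTT : ∀ q ∈ (S ×ˢ I), fderiv ℝ (fderiv ℝ θ) (Γ q.1 + Gd q • rotJ (deriv Γ q.1) + q.2 • e2) (deriv Γ q.1) (deriv Γ q.1) = 0 := by
    intro q hq
    have h := fderiv_eq_zero_of_eqOn_prod hS hI hTW hq (1, 0)
    rw [fderiv_moving_deriv hΓ hpl hk (hGdd q hq) hθ2 (hTd q.1), hGd_fd q hq] at h
    have hν0q := hνW q hq
    simp only [map_smul, _root_.smul_apply, smul_eq_mul, mul_zero, zero_smul, add_zero, one_mul] at h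
    have hkey : (1 - k q.1 * Gd q) * fderiv ℝ (fderiv ℝ θ) (Γ q.1 + Gd q • rotJ (deriv Γ q.1) + q.2 • e2) (deriv Γ q.1)
        (deriv Γ q.1) = 0 := by
      linear_combination h - k q.1 * hν0q
    rcases mul_eq_zero.1 hkey with h1 | h1
    · exact absurd h1 (hJ q.1 hq.1 q.2 hq.2)
    · exact h1
  -- notation at the point
  set p : ℝ × ℝ := (s, z) with hp_def
  have hp : p ∈ (S ×ˢ I) := ⟨hs, hz⟩
  set x : EuclideanSpace ℝ (Fin 3) := Γ s + d z • rotJ (deriv Γ s) + z • e2 with hx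
  set T : EuclideanSpace ℝ (Fin 3) := deriv Γ s with hTdef
  set ν : EuclideanSpace ℝ (Fin 3) := rotJ (deriv Γ s) with hνdef
  set B := fderiv ℝ (fderiv ℝ θ) x with hB
  set D := fderiv ℝ (fderiv ℝ (fderiv ℝ θ)) x with hD
  set J : ℝ := 1 - k s * d z with hJdef
  have hJp : 1 - k p.1 * Gd p = J := by simp [hJdef, hp_def, hGd]
  have hxW : Γ p.1 + Gd p • rotJ (deriv Γ p.1) + p.2 • e2 = x := by simp [hx, hp_def, hGd, hνdef]
  have hi : B T ν = 0 := by have := hBTν p hp; rwa [hxW] at this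
  have hii : B T T = 0 := by have := hBTT p hp; rwa [hxW] at this
  /- (iii) `J·D³θ[ν,T,T] = −k·B[ν,ν]` at the point (second `s`-derivative). -/
  have hE1 : J * D ν T T + k s * B ν ν = 0 := by
    have h := fderiv_eq_zero_of_eqOn_prod hS hI hBTν hp (1, 0)
    rw [fderiv_moving_hessian hΓ hpl hk (hGdd p hp) hθ3 (hTd p.1) (hNd p.1), hGd_fd p hp, hxW, hJp] at h
    simp only [map_smul, _root_.smul_apply, smul_eq_mul, mul_zero, zero_smul, add_zero, one_mul] at h
    have hsw : fderiv ℝ (fderiv ℝ (fderiv ℝ θ)) x T T ν = fderiv ℝ (fderiv ℝ (fderiv ℝ θ)) x ν T T := by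
      rw [fderiv3_swap23 hθ3 x T T ν, fderiv3_swap12 hθ3 x T ν T]
    simp only [hB, hD, hTdef, hνdef, hp_def, hJdef] at hii hsw h ⊢
    linear_combination h - (1 - k s * d z) * hsw + k s * hii
  /- (iv) `∂_z` of `∂_νθ(W) = 0`, once (on the region) and (v) twice (at the point). -/
  have hI1z : ∀ q ∈ (S ×ˢ I), (fun q : ℝ × ℝ => deriv d q.2 *
      fderiv ℝ (fderiv ℝ θ) (Γ q.1 + Gd q • rotJ (deriv Γ q.1) + q.2 • e2) (rotJ (deriv Γ q.1)) (rotJ (deriv Γ q.1)) +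
        fderiv ℝ (fderiv ℝ θ) (Γ q.1 + Gd q • rotJ (deriv Γ q.1) + q.2 • e2) e2 (rotJ (deriv Γ q.1))) q = 0 := by
    intro q hq
    have h := fderiv_eq_zero_of_eqOn_prod hS hI hνW hq (0, 1)
    rw [fderiv_moving_deriv hΓ hpl hk (hGdd q hq) hθ2 (hNd q.1), hGd_fd q hq] at h
    simp only [map_add, map_smul, _root_.add_apply, _root_.smul_apply, smul_eq_mul, zero_mul, zero_smul, zero_add,
      mul_one, one_smul] at h
    simp only
    linear_combination h
  have hiv : deriv d z * B ν ν + B e2 ν = 0 := by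
    have := hI1z p hp; simp only [hp_def] at this; simpa [hB, hνdef] using this
  have hE3 : deriv (deriv d) z * B ν ν + deriv d z * (deriv d z * D ν ν ν + D e2 ν ν) + (deriv d z * D ν e2 ν + D e2 e2 ν) = 0 := by
    have h := fderiv_eq_zero_of_eqOn_prod hS hI hI1z hp (0, 1)
    have hm1 : DifferentiableAt ℝ (fun q : ℝ × ℝ =>
        fderiv ℝ (fderiv ℝ θ) (Γ q.1 + Gd q • rotJ (deriv Γ q.1) + q.2 • e2) (rotJ (deriv Γ q.1)) (rotJ (deriv Γ q.1))) p :=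
      differentiableAt_moving_hessian hΓ hpl hk (hGdd p hp) hθ3 (hNd p.1) (hNd p.1)
    have hm2 : DifferentiableAt ℝ (fun q : ℝ × ℝ =>
        fderiv ℝ (fderiv ℝ θ) (Γ q.1 + Gd q • rotJ (deriv Γ q.1) + q.2 • e2) e2 (rotJ (deriv Γ q.1))) p :=
      differentiableAt_moving_hessian hΓ hpl hk (hGdd p hp) hθ3 (V₁ := fun _ => e2) (V₁' := 0) (hasDerivAt_const p.1 e2) (hNd p.1)
    rw [fderiv_fun_add ((hd'q p hp).differentiableAt.fun_mul hm1) hm2, fderiv_fun_mul (hd'q p hp).differentiableAt hm1] at h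
    simp only [_root_.add_apply, _root_.smul_apply, smul_eq_mul] at h
    rw [(hd'q p hp).fderiv, fderiv_moving_hessian hΓ hpl hk (hGdd p hp) hθ3 (hNd p.1) (hNd p.1),
      fderiv_moving_hessian hΓ hpl hk (hGdd p hp) hθ3 (V₁ := fun _ => e2) (V₁' := 0) (hasDerivAt_const p.1 e2) (hNd p.1),
      hGd_fd p hp, hxW] at h
    simp only [ContinuousLinearMap.comp_apply, ContinuousLinearMap.coe_snd', ContinuousLinearMap.smulRight_apply,
      ContinuousLinearMap.one_def, ContinuousLinearMap.id_apply, smul_eq_mul, map_add, map_smul, map_zero,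
      _root_.add_apply, _root_.smul_apply, _root_.zero_apply, zero_mul, zero_smul, zero_add, mul_one, one_smul,
      add_zero] at h
    simp only [hB, hD, hνdef, hp_def] at h ⊢
    linear_combination h
  /- (vii) the derivative of `a(z') = D²θ(W(s,z'))[ν,ν]` along the height. -/
  have hline : HasDerivAt (fun z' : ℝ => Γ s + d z' • rotJ (deriv Γ s) + z' • e2) (deriv d z • ν + e2) z := by
    have h := (((hdd z hz).hasDerivAt.smul_const (rotJ (deriv Γ s))).const_add (Γ s)).fun_add ((hasDerivAt_id' z).smul_const e2)
    rw [one_smul] at h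
    exact h
  have hα : HasDerivAt (fun z' : ℝ => fderiv ℝ (fderiv ℝ θ) (Γ s + d z' • rotJ (deriv Γ s) + z' • e2) (rotJ (deriv Γ s)) (rotJ (deriv Γ s)))
      (deriv d z * D ν ν ν + D e2 ν ν) z := by
    have hc := (hD2 x).hasFDerivAt.comp_hasDerivAt z hline
    have h := (hc.clm_apply (hasDerivAt_const z ν)).clm_apply (hasDerivAt_const z ν)
    refine h.congr_deriv ?_
    simp [hD, hνdef, map_add, map_smul]
  /- (vi) `∂_ν` of the slice law at the point + frame invariance. -/
  have hL1 : D ν e2 e2 + μ z * (D ν T T + D ν ν ν) = 0 := by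
    set S : EuclideanSpace ℝ (Fin 3) → ℝ := fun y => fderiv ℝ (fderiv ℝ θ) y e2 e2 +
      μ (y 2) * (fderiv ℝ (fderiv ℝ θ) y e0 e0 + fderiv ℝ (fderiv ℝ θ) y e1 e1) with hS
    have hSO : IsOpen {y : EuclideanSpace ℝ (Fin 3) | y 2 ∈ I} := hI.preimage (EuclideanSpace.proj (𝕜 := ℝ) (2 : Fin 3)).continuous
    have hS0 : ∀ y ∈ {y : EuclideanSpace ℝ (Fin 3) | y 2 ∈ I}, S y = 0 := by
      intro y hy
      have h := hlaw y hy
      rw [nested_eq_fderiv_fderiv hθ2, nested_eq_fderiv_fderiv hθ2, nested_eq_fderiv_fderiv hθ2] at h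
      simp only [hS, e0, e1, e2]
      linear_combination h
    have hx2 : x 2 = z := by simp [hx, hνdef, hpl, hν2s s, e2]
    have hxmem : x ∈ {y : EuclideanSpace ℝ (Fin 3) | y 2 ∈ I} := by show x 2 ∈ I; rw [hx2]; exact hz
    have hev : S =ᶠ[𝓝 x] fun _ => 0 := Filter.eventuallyEq_of_mem (hSO.mem_nhds hxmem) fun y hy => hS0 y hy
    have hSfd : fderiv ℝ S x ν = 0 := by rw [hev.fderiv_eq]; simp
    have hμy : HasFDerivAt (fun y : EuclideanSpace ℝ (Fin 3) => μ (y 2))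
        ((ContinuousLinearMap.smulRight (1 : ℝ →L[ℝ] ℝ) (deriv μ z)).comp (EuclideanSpace.proj (𝕜 := ℝ) (2 : Fin 3))) x := by
      have h1 : HasDerivAt μ (deriv μ z) (x 2) := by rw [hx2]; exact (hμ z hz).hasDerivAt
      exact h1.hasFDerivAt.comp x (EuclideanSpace.proj (𝕜 := ℝ) (2 : Fin 3)).hasFDerivAt
    have hBc : ∀ a b : EuclideanSpace ℝ (Fin 3), HasFDerivAt (fun y => fderiv ℝ (fderiv ℝ θ) y a b)
        (fderiv ℝ (fun y => fderiv ℝ (fderiv ℝ θ) y a b) x) x := fun a b =>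
      (((hD2 x).clm_apply (differentiableAt_const a)).clm_apply (differentiableAt_const b)).hasFDerivAt
    have hS' := (hBc e2 e2).add (hμy.mul ((hBc e0 e0).add (hBc e1 e1)))
    have hS'' : HasFDerivAt S _ x := hS'
    rw [hS''.fderiv] at hSfd
    simp only [_root_.add_apply, _root_.smul_apply, smul_eq_mul, ContinuousLinearMap.comp_apply,
      ContinuousLinearMap.smulRight_apply, ContinuousLinearMap.one_def, ContinuousLinearMap.id_apply,
      fderiv_hessian_apply_const hθ3, Pi.add_apply] at hSfd
    have hν2 : (EuclideanSpace.proj (𝕜 := ℝ) (2 : Fin 3)) ν = 0 := hν2s s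
    rw [hν2, hx2] at hSfd
    have hft := frame_trace (D ν) (hT2s s) (hun s)
    simp only [mul_zero, zero_mul, add_zero] at hSfd
    simp only [hD, hTdef, hνdef] at hft hSfd ⊢
    linear_combination hSfd + μ z * hft
  -- slot swaps for (v)
  have hsw1 : D ν e2 ν = D e2 ν ν := by rw [hD, fderiv3_swap12 hθ3]
  have hsw2 : D e2 e2 ν = D ν e2 e2 := by rw [hD, fderiv3_swap23 hθ3 x e2 e2 ν, fderiv3_swap12 hθ3 x e2 ν e2]
  have hv : deriv (deriv d) z * B ν ν + deriv d z ^ 2 * D ν ν ν + 2 * deriv d z * D e2 ν ν + D ν e2 e2 = 0 := by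
    rw [hsw1, hsw2] at hE3
    linear_combination hE3
  refine ⟨hi, hii, ?_, hiv, ?_, ?_, ?_⟩
  · simpa [hJdef] using hE1
  · simpa [hB, hD, hx, hνdef] using hv
  · simpa [hD, hx, hνdef, hTdef] using hL1
  · simpa [hD, hx, hνdef] using hα

/-- ★ **THE CUBIC LAW ON A CURVED PARALLEL WEB SHEET (division-free):** `J·((d′² + μ)·a₃ − 2d′·∂_z a₂ − d″·a₂) = μ·k·a₂`, with
`∂_z a₂ = d′·a₃ + D³θ[e₂,ν,ν]` (item (vii) of `curved_sheet_jet`).  Characteristic heights (`d′² + μ = 0`): K2-p2's transport law;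
non-characteristic heights: the transversal cubic `a₃` is an explicit function of the web data. -/
theorem curved_sheet_cubic_law_on {θ : EuclideanSpace ℝ (Fin 3) → ℝ} (hθ : ContDiff ℝ ∞ θ)
    {S I : Set ℝ} (hS : IsOpen S) (hI : IsOpen I) {μ d : ℝ → ℝ} (hμ : ∀ z ∈ I, DifferentiableAt ℝ μ z) (hd : ContDiffOn ℝ ∞ d I)
    {Γ : ℝ → EuclideanSpace ℝ (Fin 3)} (hΓ : ContDiff ℝ 2 Γ) (hpl : ∀ s, Γ s 2 = 0) (hun : ∀ s, ‖deriv Γ s‖ = 1)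
    {k : ℝ → ℝ} (hk : ∀ s, deriv (deriv Γ) s = k s • rotJ (deriv Γ s))
    (hJ : ∀ s ∈ S, ∀ z ∈ I, 1 - k s * d z ≠ 0)
    (hlaw : ∀ x : EuclideanSpace ℝ (Fin 3), x 2 ∈ I →
      fderiv ℝ (fun y => fderiv ℝ θ y (EuclideanSpace.single 2 (1 : ℝ))) x (EuclideanSpace.single 2 (1 : ℝ)) =
        -μ (x 2) * (fderiv ℝ (fun y => fderiv ℝ θ y (EuclideanSpace.single 0 (1 : ℝ))) x (EuclideanSpace.single 0 (1 : ℝ)) +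
          fderiv ℝ (fun y => fderiv ℝ θ y (EuclideanSpace.single 1 (1 : ℝ))) x (EuclideanSpace.single 1 (1 : ℝ))))
    (hν : ∀ s ∈ S, ∀ z ∈ I, fderiv ℝ θ (Γ s + d z • rotJ (deriv Γ s) + z • e2) (rotJ (deriv Γ s)) = 0)
    (hT : ∀ s ∈ S, ∀ z ∈ I, fderiv ℝ θ (Γ s + d z • rotJ (deriv Γ s) + z • e2) (deriv Γ s) = 0)
    {s z : ℝ} (hs : s ∈ S) (hz : z ∈ I) :
    (1 - k s * d z) *
        ((deriv d z ^ 2 + μ z) *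
              fderiv ℝ (fderiv ℝ (fderiv ℝ θ)) (Γ s + d z • rotJ (deriv Γ s) + z • e2) (rotJ (deriv Γ s)) (rotJ (deriv Γ s)) (rotJ (deriv Γ s)) -
            2 * deriv d z *
              (deriv d z * fderiv ℝ (fderiv ℝ (fderiv ℝ θ)) (Γ s + d z • rotJ (deriv Γ s) + z • e2) (rotJ (deriv Γ s)) (rotJ (deriv Γ s)) (rotJ (deriv Γ s)) +
                fderiv ℝ (fderiv ℝ (fderiv ℝ θ)) (Γ s + d z • rotJ (deriv Γ s) + z • e2) e2 (rotJ (deriv Γ s)) (rotJ (deriv Γ s))) -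
          deriv (deriv d) z * fderiv ℝ (fderiv ℝ θ) (Γ s + d z • rotJ (deriv Γ s) + z • e2) (rotJ (deriv Γ s)) (rotJ (deriv Γ s))) =
      μ z * k s * fderiv ℝ (fderiv ℝ θ) (Γ s + d z • rotJ (deriv Γ s) + z • e2) (rotJ (deriv Γ s)) (rotJ (deriv Γ s)) := by
  obtain ⟨-, -, h3, -, h5, h6, -⟩ := curved_sheet_jet_on hθ hS hI hμ hd hΓ hpl hun hk hJ hlaw hν hT hs hz
  linear_combination (1 - k s * d z) * h6 - (1 - k s * d z) * h5 - μ z * h3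

/-- **The cubic law solved for `a₃` on a non-characteristic height** (`d′² + μ ≠ 0`, `J ≠ 0`):
`a₃ = (2d′·∂_z a₂ + d″·a₂ + μ·k·a₂/J)/(d′² + μ)`. -/
theorem curved_sheet_cubic_law_on' {θ : EuclideanSpace ℝ (Fin 3) → ℝ} (hθ : ContDiff ℝ ∞ θ)
    {S I : Set ℝ} (hS : IsOpen S) (hI : IsOpen I) {μ d : ℝ → ℝ} (hμ : ∀ z ∈ I, DifferentiableAt ℝ μ z) (hd : ContDiffOn ℝ ∞ d I)
    {Γ : ℝ → EuclideanSpace ℝ (Fin 3)} (hΓ : ContDiff ℝ 2 Γ) (hpl : ∀ s, Γ s 2 = 0) (hun : ∀ s, ‖deriv Γ s‖ = 1)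
    {k : ℝ → ℝ} (hk : ∀ s, deriv (deriv Γ) s = k s • rotJ (deriv Γ s))
    (hJ : ∀ s ∈ S, ∀ z ∈ I, 1 - k s * d z ≠ 0)
    (hlaw : ∀ x : EuclideanSpace ℝ (Fin 3), x 2 ∈ I →
      fderiv ℝ (fun y => fderiv ℝ θ y (EuclideanSpace.single 2 (1 : ℝ))) x (EuclideanSpace.single 2 (1 : ℝ)) =
        -μ (x 2) * (fderiv ℝ (fun y => fderiv ℝ θ y (EuclideanSpace.single 0 (1 : ℝ))) x (EuclideanSpace.single 0 (1 : ℝ)) +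
          fderiv ℝ (fun y => fderiv ℝ θ y (EuclideanSpace.single 1 (1 : ℝ))) x (EuclideanSpace.single 1 (1 : ℝ))))
    (hν : ∀ s ∈ S, ∀ z ∈ I, fderiv ℝ θ (Γ s + d z • rotJ (deriv Γ s) + z • e2) (rotJ (deriv Γ s)) = 0)
    (hT : ∀ s ∈ S, ∀ z ∈ I, fderiv ℝ θ (Γ s + d z • rotJ (deriv Γ s) + z • e2) (deriv Γ s) = 0)
    {s z : ℝ} (hs : s ∈ S) (hz : z ∈ I) (hQ : deriv d z ^ 2 + μ z ≠ 0) :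
    fderiv ℝ (fderiv ℝ (fderiv ℝ θ)) (Γ s + d z • rotJ (deriv Γ s) + z • e2) (rotJ (deriv Γ s)) (rotJ (deriv Γ s)) (rotJ (deriv Γ s)) =
      (2 * deriv d z *
            (deriv d z * fderiv ℝ (fderiv ℝ (fderiv ℝ θ)) (Γ s + d z • rotJ (deriv Γ s) + z • e2) (rotJ (deriv Γ s)) (rotJ (deriv Γ s)) (rotJ (deriv Γ s)) +
              fderiv ℝ (fderiv ℝ (fderiv ℝ θ)) (Γ s + d z • rotJ (deriv Γ s) + z • e2) e2 (rotJ (deriv Γ s)) (rotJ (deriv Γ s))) +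
          deriv (deriv d) z * fderiv ℝ (fderiv ℝ θ) (Γ s + d z • rotJ (deriv Γ s) + z • e2) (rotJ (deriv Γ s)) (rotJ (deriv Γ s)) +
        μ z * k s * fderiv ℝ (fderiv ℝ θ) (Γ s + d z • rotJ (deriv Γ s) + z • e2) (rotJ (deriv Γ s)) (rotJ (deriv Γ s)) / (1 - k s * d z)) /
        (deriv d z ^ 2 + μ z) := by
  have h := curved_sheet_cubic_law_on hθ hS hI hμ hd hΓ hpl hun hk hJ hlaw hν hT hs hz
  have hJ0 := hJ s hs z hz
  field_simp
  linear_combination h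

end Summit.NavierStokesRegularity.NavierStokesRegularity.Theorems.PoloidalWindowDoorLrcModEntireCurvedSheetJetLocal

end
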